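import Summits.NavierStokesRegularity.FluidComputer.GateBudgetFiringTeeth
import HarnessLib

/-!
# What no tuning can beat, part 26: THE DRAIN IS A RICCATI CLOCK — while `d² + ã² ≥ m` the output
# obeys `√m·tanh(K√m(t - T)) ≤ ã(t)`, and always `ã(t) ≤ tanh(K(t - T) + artanh ã(T))`: behind a
# pin the tooth is squeezed between two solutions of Tao's own switching equation `∂ₜy = K(1 - y²)`

Cell `pub-fluidc`, blueprint seat bp1 (gen 31, fifth item, first third); same namespace and
conventions as parts 1–25 (`GateBudget*.lean`); imports part 22a (`GateBudgetFiringTeeth`: the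
transfer freeze behind a dead clock, and through it parts 17, 16). Modes `0 = a` input, `1 = b`
clock, `2 = c` catalyst (`u = c/ρ²`), `3 = d` transfer, `4 = ã` output; `σ_knob = ρ²/ε`.
HONEST FRAMING (verbatim): low prior, high value-of-information experiment on Tao's machine
paradigm; NOT a claim that NS blows up.

THE POINT. Every firing statement of parts 22a–25b converts the frozen pair `d² + ã² ≥ m` into
output through part 22a's CHORD `knob_drain_fires`: `∂ₜã = Kd² ≥ K(m - θ²)` while `ã ≤ θ`, a
linear bound that forgets that the drain is autonomous in `(d, ã)`. But with `d² ≥ m - ã²` the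
output equation (5.5) reads `∂ₜã ≥ K(m - ã²)` — a RICCATI inequality whose extremal is Tao's own
switching profile `√m·tanh(K√m·s)` ((tcable): the abrupt delay transfers energy along a `tanh`) —
and with energy conservation `d² ≤ 1 - ã²` it reads `∂ₜã ≤ K(1 - ã²)`. §77 proves both
comparisons by the monotone log-ratio `log((√m + ã)/(√m - ã)) - 2K√m·t` (floor,
`knob_drain_riccati`, stated in `tanh` form so that no junk value of `artanh` enters when
`ã ≥ √m`) and `2K·t - log((1 + ã)/(1 - ã))` (ceiling, `knob_drain_ratio` as the product law
`(1 + ã(t))(1 - ã(T)) ≤ e^{2K(t-T)}(1 + ã(T))(1 - ã(t))`, and `knob_drain_ceiling` in `tanh ∘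
artanh` form), using only `HasDerivAt.log` and the project's `monotoneOn_sub_of_le_deriv`. §78
puts them behind a pin on the self-timed window `[T, T + β/(2ε)]` of part 22a: for every level
`0 < m ≤ L² - A′` (`|d(T)| ≥ L`, `A′ = 2ελ₀/(Mβ) + e^{-M}/M` the afterglow of
`knob_transfer_freeze_selftimed`) the floor `√m·tanh(K√m(t - T)) ≤ ã(t)` (`knob_member_rate_of_pin`,
the Riccati version of part 25a's `knob_member_fire_of_pin`), and the ceiling with `ã < 1`
supplied by the dead clock (`clock_stays_reversed` + energy; `knob_member_ceiling_selftimed`).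
CONSEQUENCE (part 27, `GateBudgetToothClock`): at Tao's amplifier a pinned tooth crosses `3/4` at
`T + (0.98 ± 0.02)/K` and `19/20` at `T + (1.9 ± 0.1)/K` — the switching delay after clock death
is `≈ 1/K` whatever the knob, where the chord only gave "by `T + 1/8`".

HONEST LIMITS. (i) Comparison only: the floor needs the freeze `d² + ã² ≥ m` as a hypothesis on
the whole interval and says nothing after the self-timed window; the ceiling needs `ã(T') < 1`.
(ii) The floor is sharp only while `d² + ã² ≈ m` (no second pulse is excluded here). (iii) `tanh`
monotonicity is never used: levels are compared through `m ↦ √m·tanh(K√m·s)` at fixed `m`.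
(iv) Nothing about Navier–Stokes.
[cite: Tao2016AveragedNS, §5.5 Theorem 5.3, (5.5), (5.6), (b-eq), (c-eq), (tcable)]
-/

noncomputable section

namespace Summit.NavierStokesRegularity.FluidComputer.GateBudget

open Real Set Filter Topology
open Literature.Analysis.FluidPDE.Tao2016AveragedNS
open Literature.Analysis.FluidPDE.Tao2016AveragedNS.Thm53 (monotoneOn_sub_of_le_deriv)

variable {K M ε ρ : ℝ} {X : ℝ → Fin 5 → ℝ}

/-! ## §77 The drain is a Riccati clock: `K(m - ã²) ≤ ∂ₜã ≤ K(1 - ã²)` -/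

/-- **THE RICCATI FLOOR.** Along `rotorCircuit K M ε ρ` from (5.6) (`K ≥ 0`): if on `[T, T']`
the output pair stays above a level, `d² + ã² ≥ m > 0`, and `ã(T) ≥ 0`, then for every
`t ∈ [T, T']`, `ã(t) ≥ √m·tanh(K√m(t - T))` — the solution of `∂ₜy = K(m - y²)`, `y(T) = 0`.
Were `ã(t) < √m·tanh(K√m(t - T))`, then `0 ≤ ã < √m` on `[T, t]` (`ã` is non-decreasing), the
log-ratio `g = log(√m + ã) - log(√m - ã)` is differentiable there with
`g' = 2√m·∂ₜã/(m - ã²) = 2√m·Kd²/(m - ã²) ≥ 2K√m` (`d² ≥ m - ã²`), so `g(t) ≥ g(T) + 2K√m(t - T)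
≥ 2K√m(t - T)`, i.e. `(√m + ã)/(√m - ã) ≥ e^{2K√m(t-T)}`, which is `ã(t) ≥ √m·tanh(K√m(t - T))`.
Part 22a's `knob_drain_fires` is its chord `θ ≤ K(m - θ²)(T' - T)`.
[cite: Tao2016AveragedNS, §5.5 (5.5), (ta-eq)] -/
theorem knob_drain_riccati (hX : ∀ t, HasDerivAt X (RotorKnob.rotorCircuit K M ε ρ (X t)) t)
    (hK : 0 ≤ K) {T T' m : ℝ} (hm0 : 0 < m) (he : 0 ≤ X T 4)
    (hm : ∀ t ∈ Icc T T', m ≤ X t 3 ^ 2 + X t 4 ^ 2) {t : ℝ} (ht : t ∈ Icc T T') :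
    √m * tanh (K * √m * (t - T)) ≤ X t 4 := by
  have hr0 : 0 < √m := sqrt_pos.2 hm0
  have hrm : √m ^ 2 = m := sq_sqrt hm0.le
  have hmon := RotorKnob.rotorCircuit_output_monotone hK hX
  have htanh : ∀ y : ℝ, tanh y = (exp (2 * y) - 1) / (exp (2 * y) + 1) := fun y => by
    rw [Real.tanh_eq, two_mul, exp_add, exp_neg]
    field_simp
  refine not_lt.1 fun hlt => ?_
  -- then `ã(t) < √m`, so `0 ≤ ã < √m` on `[T, t]`
  have het : X t 4 < √m := by
    have h1 : tanh (K * √m * (t - T)) < 1 := Real.tanh_lt_one _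
    nlinarith
  -- the log-ratio climbs at rate `≥ 2K√m` on `[T, t]`
  have hmono := monotoneOn_sub_of_le_deriv
    (f := fun s => log (√m + X s 4) - log (√m - X s 4))
    (f' := fun s => (0 + K * X s 3 ^ 2) / (√m + X s 4) - (0 - K * X s 3 ^ 2) / (√m - X s 4))
    (φ := fun _ => 2 * K * √m) (Φ := fun s => 2 * K * √m * s) (convex_Icc T t)
    (fun s hs => by
      have h1 : 0 < √m + X s 4 := by linarith [hmon hs.1]
      have h2 : 0 < √m - X s 4 := by linarith [hmon hs.2]
      exact (((hasDerivAt_const s (√m)).add (RotorKnob.hasDerivAt_e hX s)).log h1.ne').sub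
        (((hasDerivAt_const s (√m)).sub (RotorKnob.hasDerivAt_e hX s)).log h2.ne'))
    (fun s _ => by simpa using (hasDerivAt_id' s).const_mul (2 * K * √m))
    (fun s hs => by
      have h1 : 0 < √m + X s 4 := by linarith [hmon hs.1]
      have h2 : 0 < √m - X s 4 := by linarith [hmon hs.2]
      have hd2 : (√m + X s 4) * (√m - X s 4) ≤ X s 3 ^ 2 := by
        nlinarith [hm s ⟨hs.1, hs.2.trans ht.2⟩]
      show 2 * K * √m ≤ (0 + K * X s 3 ^ 2) / (√m + X s 4) - (0 - K * X s 3 ^ 2) / (√m - X s 4)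
      rw [show (0 + K * X s 3 ^ 2) / (√m + X s 4) - (0 - K * X s 3 ^ 2) / (√m - X s 4)
          = 2 * √m * (K * X s 3 ^ 2) / ((√m + X s 4) * (√m - X s 4)) by
            field_simp
            ring,
        le_div_iff₀ (mul_pos h1 h2)]
      nlinarith [mul_le_mul_of_nonneg_left hd2 (by positivity : 0 ≤ 2 * K * √m)])
  have h := hmono (left_mem_Icc.2 ht.1) (right_mem_Icc.2 ht.1) ht.1
  dsimp only at h
  -- `g(T) ≥ 0`, so `log(√m + ã(t)) ≥ 2K√m(t - T) + log(√m - ã(t))`; exponentiate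
  have h2T : 0 < √m - X T 4 := by linarith [hmon ht.1]
  have hgT : 0 ≤ log (√m + X T 4) - log (√m - X T 4) := by
    have := log_le_log h2T (by linarith : √m - X T 4 ≤ √m + X T 4)
    linarith
  have h1t : 0 < √m + X t 4 := by linarith [hmon ht.1]
  have h2t : 0 < √m - X t 4 := by linarith
  have hge : 2 * (K * √m * (t - T)) + log (√m - X t 4) ≤ log (√m + X t 4) := by linarith
  have hexp := exp_le_exp.2 hge
  rw [exp_add, exp_log h2t, exp_log h1t] at hexp
  have hE : 0 < exp (2 * (K * √m * (t - T))) := exp_pos _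
  have hle : √m * tanh (K * √m * (t - T)) ≤ X t 4 := by
    rw [htanh, ← mul_div_assoc, div_le_iff₀ (by linarith)]
    nlinarith
  exact absurd hle (not_le.2 hlt)

/-- **THE RICCATI CEILING (ratio law).** Along `rotorCircuit K M ε ρ` from (5.6) (`K ≥ 0`,
`T ≥ 0`): if `ã(T') < 1` then for every `t ∈ [T, T']`,
`(1 + ã(t))(1 - ã(T)) ≤ e^{2K(t-T)}(1 + ã(T))(1 - ã(t))`, i.e. the log-ratio
`log(1 + ã) - log(1 - ã) = 2·artanh ã` (`0 ≤ ã ≤ ã(T') < 1` on `[T, T']`) climbs at rate `≤ 2K`: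
by energy conservation `d² ≤ 1 - ã²`, so `∂ₜã = Kd² ≤ K(1 - ã²)`. The output is NO FASTER than
the free Riccati clock `∂ₜy = K(1 - y²)`. [cite: Tao2016AveragedNS, §5.5 (5.5), (energy-con)] -/
theorem knob_drain_ratio (hX : ∀ t, HasDerivAt X (RotorKnob.rotorCircuit K M ε ρ (X t)) t)
    (h0 : X 0 = delayInit) (hK : 0 ≤ K) {T T' : ℝ} (hT : 0 ≤ T) (he1 : X T' 4 < 1) {t : ℝ}
    (ht : t ∈ Icc T T') :
    (1 + X t 4) * (1 - X T 4) ≤ exp (2 * (K * (t - T))) * ((1 + X T 4) * (1 - X t 4)) := by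
  have hmon := RotorKnob.rotorCircuit_output_monotone hK hX
  have heT : 0 ≤ X T 4 := RotorKnob.e_nonneg hX h0 hK hT
  -- the log-ratio `log(1 + ã) - log(1 - ã)` climbs at rate `≤ 2K` on `[T, T']`
  have hmono := monotoneOn_sub_of_le_deriv (f := fun s => 2 * K * s) (f' := fun _ => 2 * K)
    (Φ := fun s => log (1 + X s 4) - log (1 - X s 4))
    (φ := fun s => (0 + K * X s 3 ^ 2) / (1 + X s 4) - (0 - K * X s 3 ^ 2) / (1 - X s 4))
    (convex_Icc T T')
    (fun s _ => by simpa using (hasDerivAt_id' s).const_mul (2 * K))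
    (fun s hs => by
      have h1 : 0 < 1 + X s 4 := by linarith [hmon hs.1]
      have h2 : 0 < 1 - X s 4 := by linarith [hmon hs.2]
      exact (((hasDerivAt_const s (1:ℝ)).add (RotorKnob.hasDerivAt_e hX s)).log h1.ne').sub
        (((hasDerivAt_const s (1:ℝ)).sub (RotorKnob.hasDerivAt_e hX s)).log h2.ne'))
    (fun s hs => by
      have h1 : 0 < 1 + X s 4 := by linarith [hmon hs.1]
      have h2 : 0 < 1 - X s 4 := by linarith [hmon hs.2]
      -- energy: `d² ≤ 1 - ã²`
      have hE := RotorKnob.traj_sum_sq_eq_one hX h0 s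
      have hd2 : X s 3 ^ 2 ≤ (1 + X s 4) * (1 - X s 4) := by
        nlinarith [sq_nonneg (X s 0), sq_nonneg (X s 1), sq_nonneg (X s 2)]
      show (0 + K * X s 3 ^ 2) / (1 + X s 4) - (0 - K * X s 3 ^ 2) / (1 - X s 4) ≤ 2 * K
      rw [show (0 + K * X s 3 ^ 2) / (1 + X s 4) - (0 - K * X s 3 ^ 2) / (1 - X s 4)
          = 2 * (K * X s 3 ^ 2) / ((1 + X s 4) * (1 - X s 4)) by
            field_simp
            ring,
        div_le_iff₀ (mul_pos h1 h2)]
      nlinarith [mul_le_mul_of_nonneg_left hd2 hK])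
  have h := hmono (left_mem_Icc.2 (ht.1.trans ht.2)) ht ht.1
  dsimp only at h
  have h1t : 0 < 1 + X t 4 := by linarith [hmon ht.1]
  have h2t : 0 < 1 - X t 4 := by linarith [hmon ht.2]
  have h1T : 0 < 1 + X T 4 := by linarith
  have h2T : 0 < 1 - X T 4 := by linarith [hmon (ht.1.trans ht.2)]
  -- exponentiate
  have hge : log (1 + X t 4) + log (1 - X T 4)
      ≤ 2 * (K * (t - T)) + (log (1 + X T 4) + log (1 - X t 4)) := by linarith
  have hexp := exp_le_exp.2 hge
  rwa [exp_add, exp_add, exp_add, exp_log h1t, exp_log h2T, exp_log h1T, exp_log h2t] at hexp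

/-- **THE RICCATI CEILING.** Under the hypotheses of `knob_drain_ratio`, for every `t ∈ [T, T']`,
`ã(t) ≤ tanh(K(t - T) + artanh ã(T))` — the solution of `∂ₜy = K(1 - y²)` from `ã(T)`
(`e^{2·artanh x} = (1 + x)/(1 - x)`): a tooth cannot reach a level `θ < 1` before
`T + (artanh θ - artanh ã(T))/K`. [cite: Tao2016AveragedNS, §5.5 (5.5), (energy-con)] -/
theorem knob_drain_ceiling (hX : ∀ t, HasDerivAt X (RotorKnob.rotorCircuit K M ε ρ (X t)) t)
    (h0 : X 0 = delayInit) (hK : 0 ≤ K) {T T' : ℝ} (hT : 0 ≤ T) (he1 : X T' 4 < 1) {t : ℝ}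
    (ht : t ∈ Icc T T') : X t 4 ≤ tanh (K * (t - T) + artanh (X T 4)) := by
  have hmon := RotorKnob.rotorCircuit_output_monotone hK hX
  have heT : 0 ≤ X T 4 := RotorKnob.e_nonneg hX h0 hK hT
  have key := knob_drain_ratio hX h0 hK hT he1 ht
  have htanh : ∀ y : ℝ, tanh y = (exp (2 * y) - 1) / (exp (2 * y) + 1) := fun y => by
    rw [Real.tanh_eq, two_mul, exp_add, exp_neg]
    field_simp
  have h2t : 0 < 1 - X t 4 := by linarith [hmon ht.2]
  have h1T : 0 < 1 + X T 4 := by linarith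
  have h2T : 0 < 1 - X T 4 := by linarith [hmon (ht.1.trans ht.2)]
  -- `e^{2 artanh ã(T)} = (1 + ã(T))/(1 - ã(T))`
  have hmem : X T 4 ∈ Ioo (-1 : ℝ) 1 := ⟨by linarith, by linarith⟩
  have hq : exp (2 * artanh (X T 4)) = (1 + X T 4) / (1 - X T 4) := by
    rw [two_mul, exp_add, Real.exp_artanh hmem, ← pow_two, sq_sqrt (div_nonneg h1T.le h2T.le)]
  have hE : 0 < exp (2 * (K * (t - T))) := exp_pos _
  rw [htanh, mul_add, exp_add, hq, le_div_iff₀ (by positivity), ← sub_nonneg]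
  rw [show exp (2 * (K * (t - T))) * ((1 + X T 4) / (1 - X T 4)) - 1
      - X t 4 * (exp (2 * (K * (t - T))) * ((1 + X T 4) / (1 - X T 4)) + 1)
      = (exp (2 * (K * (t - T))) * ((1 + X T 4) * (1 - X t 4)) - (1 + X t 4) * (1 - X T 4))
        / (1 - X T 4) by
        field_simp
        ring]
  exact div_nonneg (by linarith) h2T.le

/-! ## §78 Behind a pin: the tooth is a Riccati clock on the self-timed window -/

/-- **THE RATE BEHIND A PIN.** Along `rotorCircuit K M ε ρ` from (5.6) (`0 < ε`, `0 < ρ`,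
`0 < M`, `0 ≤ K`), if the clock is dead at `T ≥ 0` (`b(T) ≤ -β < 0`), the catalyst residue is
`u(T) ≤ λ₀` and the transfer mode is pinned `|d(T)| ≥ L ≥ 0`, then for every level
`0 < m ≤ L² - A′`, `A′ = 2ελ₀/(Mβ) + e^{-M}/M`: `ã(t) ≥ √m·tanh(K√m(t - T))` for all `t` in the
self-timed window `[T, T + β/(2ε)]`, and `ã(t) ≥ √m·tanh(K√m·β/(2ε))` for all later `t` — part
22a's transfer freeze (`knob_transfer_freeze_selftimed`: `d² + ã² ≥ L² - A′` on the window)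
converted by the Riccati floor (§77) instead of its chord (part 25a's `knob_member_fire_of_pin`).
[cite: Tao2016AveragedNS, §5.5 Theorem 5.3, (b-eq), (c-eq), (tcable)] -/
theorem knob_member_rate_of_pin
    (hX : ∀ t, HasDerivAt X (RotorKnob.rotorCircuit K M ε ρ (X t)) t) (h0 : X 0 = delayInit)
    (hε : 0 < ε) (hρ : 0 < ρ) (hM : 0 < M) (hK : 0 ≤ K) {T β lam₀ L m : ℝ} (hT : 0 ≤ T)
    (hβ : 0 < β) (hbT : X T 1 ≤ -β) (hcl : X T 2 ≤ lam₀ * ρ ^ 2) (hL : 0 ≤ L)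
    (hpin : L ≤ |X T 3|) (hm0 : 0 < m)
    (hmL : m ≤ L ^ 2 - (2 * ε * lam₀ / (M * β) + exp (-M) / M)) :
    (∀ t ∈ Icc T (T + β / (2 * ε)), √m * tanh (K * √m * (t - T)) ≤ X t 4) ∧
    (∀ t, T + β / (2 * ε) ≤ t → √m * tanh (K * √m * (β / (2 * ε))) ≤ X t 4) := by
  have hsqd : L ^ 2 ≤ X T 3 ^ 2 := by
    rw [← sq_abs (X T 3)]
    exact pow_le_pow_left₀ hL hpin 2
  have hu : X T 2 / ρ ^ 2 ≤ lam₀ := by rwa [div_le_iff₀ (by positivity)]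
  have hMβ : 0 < M * β := by positivity
  have hA : 2 * ε * (X T 2 / ρ ^ 2) / (M * β) ≤ 2 * ε * lam₀ / (M * β) :=
    div_le_div_of_nonneg_right (mul_le_mul_of_nonneg_left hu (by positivity)) hMβ.le
  -- part 22a §62: the pair is frozen above `L² - A′ ≥ m` on the self-timed window
  have hfz : ∀ t ∈ Icc T (T + β / (2 * ε)), m ≤ X t 3 ^ 2 + X t 4 ^ 2 := fun t ht => by
    have h := knob_transfer_freeze_selftimed hX h0 hε hρ hM hT hβ hbT ht
    nlinarith [sq_nonneg (X T 4)]
  have he := RotorKnob.e_nonneg hX h0 hK hT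
  have hwin : T ≤ T + β / (2 * ε) := by
    have : 0 ≤ β / (2 * ε) := by positivity
    linarith
  refine ⟨fun t ht => knob_drain_riccati hX hK hm0 he hfz ht, fun t ht => ?_⟩
  have h := knob_drain_riccati hX hK hm0 he hfz (right_mem_Icc.2 hwin)
  rw [add_sub_cancel_left] at h
  exact h.trans (RotorKnob.rotorCircuit_output_monotone hK hX ht)

/-- **THE CEILING ON THE SELF-TIMED WINDOW.** Along `rotorCircuit K M ε ρ` from (5.6) (`0 < ε`,
`0 ≤ M`, `0 ≤ K`), if the clock is dead at `T ≥ 0` (`b(T) ≤ -β < 0`) then the clock stays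
`≤ -β/2` on `[T, T + β/(2ε)]` (`clock_stays_reversed`), so `ã < 1` there (energy) and §77's
ceiling applies: for every `t` in the window
`(1 + ã(t))(1 - ã(T)) ≤ e^{2K(t-T)}(1 + ã(T))(1 - ã(t))` and `ã(t) ≤ tanh(K(t - T) + artanh ã(T))`.
[cite: Tao2016AveragedNS, §5.5 Theorem 5.3, (b-eq), (energy-con)] -/
theorem knob_member_ceiling_selftimed
    (hX : ∀ t, HasDerivAt X (RotorKnob.rotorCircuit K M ε ρ (X t)) t) (h0 : X 0 = delayInit)
    (hε : 0 < ε) (hM : 0 ≤ M) (hK : 0 ≤ K) {T β : ℝ} (hT : 0 ≤ T) (hβ : 0 < β)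
    (hbT : X T 1 ≤ -β) {t : ℝ} (ht : t ∈ Icc T (T + β / (2 * ε))) :
    (1 + X t 4) * (1 - X T 4) ≤ exp (2 * (K * (t - T))) * ((1 + X T 4) * (1 - X t 4)) ∧
    X t 4 ≤ tanh (K * (t - T) + artanh (X T 4)) := by
  have hXf := hX
  rw [RotorKnob.rotorCircuit_eq_fiveGate] at hXf
  have hμ : 0 ≤ ε⁻¹ * M := by positivity
  have hwin : T ≤ T + β / (2 * ε) := by
    have : 0 ≤ β / (2 * ε) := by positivity
    linarith
  -- at the end of the window the clock is still `≤ -β/2 < 0`, so `ã < 1` there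
  have hb := clock_stays_reversed hXf h0 hε hμ hbT (right_mem_Icc.2 hwin)
  have hE := RotorKnob.traj_sum_sq_eq_one hX h0 (T + β / (2 * ε))
  have he1 : X (T + β / (2 * ε)) 4 < 1 := by
    nlinarith [sq_nonneg (X (T + β / (2 * ε)) 0), sq_nonneg (X (T + β / (2 * ε)) 2),
      sq_nonneg (X (T + β / (2 * ε)) 3), sq_nonneg (X (T + β / (2 * ε)) 4 - 1)]
  exact ⟨knob_drain_ratio hX h0 hK hT he1 ht, knob_drain_ceiling hX h0 hK hT he1 ht⟩

end Summit.NavierStokesRegularity.FluidComputer.GateBudget
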